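import Literature.AlgebraicGeometry.Modules.Biduality
import HarnessLib

/-!
# The internal transpose `𝓗om(A, B) → 𝓗om(𝓗om(B, N), 𝓗om(A, N))` and the isomorphism
# `𝓗om(A, B) ≅ 𝓗om(B^∨, A^∨)` for finite locally free `A`, `B` (Hartshorne II Ex. 5.1)

For `𝒪_X`-modules `A, B, N` on a scheme `X` we construct the **internal transpose**

  `transposeHom A B N : 𝓗om(A, B) ⟶ 𝓗om(𝓗om(B, N), 𝓗om(A, N))`,  `ψ ↦ (χ ↦ ψ| ≫ χ)`,

i.e. the internal Hom as a functor contravariant in its first variable, now acting on LOCAL sections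
`ψ ∈ Γ(𝓗om(A, B), U) = Hom(A|_U, B|_U)` (the tree's `Modules.sheafHomMapLeft φ N` is the case of a
GLOBAL `φ : A → B`; `precompOver_over_map` relates the two). Its value on a section is the morphism of
restricted sheaves `precompOver N ψ : 𝓗om(B, N)|_U → 𝓗om(A, N)|_U`, `χ ↦ ψ|_W ≫ χ`.

For `N = 𝒪_X` this is the transpose `ψ ↦ ψ^∨ : B^∨ → A^∨`. Main results:

* `over_toBidual_comp_precompOver_precompOver` — **double transpose is biduality**: for a local
  `ψ : A|_U → B|_U`, `ev^A ≫ ψ^∨∨ = ψ ≫ ev^B` (`toBidual` is natural also in local morphisms);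
* `transposeHom_comp_transposeHom` — globally,
  `transposeHom A B N ≫ transposeHom 𝓗om(B,N) 𝓗om(A,N) N ≫ 𝓗om(ev^A, –) = 𝓗om(A, ev^B)`, and for `A`
  finite locally free `transposeDual_comp_transposeDual : T_{A,B} ≫ T_{B^∨,A^∨} = 𝓗om(A, ev^B) ≫ 𝓗om((ev^A)⁻¹, B^∨∨)`;
* **`isIso_transposeDual`** — for `A`, `B` finite locally free, `transposeDual A B : 𝓗om(A, B) → 𝓗om(B^∨, A^∨)`
  (`= transposeHom A B 𝒪_X`) is an
  ISOMORPHISM (Hartshorne II Ex. 5.1: `𝓗om(A, B) ≅ A^∨ ⊗ B ≅ 𝓗om(B^∨, A^∨)`), proved frame-free from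
  biduality (`Modules/Biduality.lean`, `isIso_toBidual`): the double transpose is conjugation by the
  biduality isomorphisms, so `T_{A,B}` is a split monomorphism and `T_{B^∨,A^∨}` a split epimorphism;
  applying the same to `(B^∨, A^∨)` makes `T_{B^∨,A^∨}` also a (split) monomorphism, hence an
  isomorphism, hence so is `T_{A,B}`; `precompOver_bijective` is the section-level reading (every
  local `B^∨|_U → A^∨|_U` is `ψ^∨` for a unique `ψ : A|_U → B|_U`).

Motivation (recorded as missing in `HodgeTheory/AtiyahClassCoherent.lean`,
`HodgeTheory/AtiyahClassCoherentNaturality.lean`): the comparison of the two models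
`𝓗om(E^∨, Ω¹)` and `𝓗om((Ω¹)^∨, E)` of `E ⊗ Ω¹` is `transposeHom E^∨ Ω¹ 𝒪 ≫ 𝓗om((Ω¹)^∨, (ev^E)⁻¹)`,
an isomorphism for `E`, `Ω¹` finite locally free by `isIso_transposeDual` + `isIso_toBidual`. Everything is
proved (theorems and plumbing definitions with bodies); no named facts.

## References

* R. Hartshorne, *Algebraic Geometry*, GTM 52 (1977), II Ex. 5.1 (a)–(b) (p. 123). [Hartshorne1977]
* The Stacks project, Tag 01CM (the internal Hom; functoriality). [StacksProject]
-/

noncomputable section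

open CategoryTheory AlgebraicGeometry Opposite TopologicalSpace Limits

namespace Literature.AlgebraicGeometry.Modules

open Literature.AlgebraicGeometry.Motives

universe u

variable {X : Scheme.{u}}

/-! ### Pre-composition with a local morphism -/

section Precomp

variable {A B C : X.Modules} (N : X.Modules) {U V : X.Opens}

/-- `overScalar a ≫ g = g ≫ overScalar a`: morphisms of restricted modules are `𝒪_X(U)`-linear
(general-scheme copy of `HodgeTheory.overScalar_comp_eq`). [folklore] -/
private lemma overScalar_comp_eq' {M M' : X.Modules} (g : M.over U ⟶ M'.over U) (a : Γ(X, U)) :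
    overScalar M U a ≫ g = g ≫ overScalar M' U a :=
  hom_ext_of_appLE fun W k s => by
    rw [appLE_comp, appLE_comp, appLE_overScalar, appLE_smul_right, appLE_overScalar]

/-- **Pre-composition with a LOCAL morphism** `ψ : A|_U → B|_U`: the morphism of restricted sheaves
`𝓗om(B, N)|_U → 𝓗om(A, N)|_U`, `χ ↦ ψ|_W ≫ χ` on sections over `W ≤ U`. [cite: StacksProject, Tag 01CM (functoriality of the internal Hom)] -/
def precompOver (ψ : A.over U ⟶ B.over U) : (sheafHom B N).over U ⟶ (sheafHom A N).over U where
  val := PresheafOfModules.homMk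
    { app := fun W => AddCommGrpCat.ofHom
        { toFun := fun χ : B.over W.unop.left ⟶ N.over W.unop.left =>
            (restrictHom W.unop.hom ψ ≫ χ : A.over W.unop.left ⟶ N.over W.unop.left)
          map_zero' := comp_zero
          map_add' := fun χ χ' => Preadditive.comp_add _ _ _ _ χ χ' }
      naturality := fun {W W'} g => by
        refine AddCommGrpCat.ext fun (χ : B.over W.unop.left ⟶ N.over W.unop.left) => ?_
        change restrictHom W'.unop.hom ψ ≫ restrictHom g.unop.left χ =
          restrictHom g.unop.left (restrictHom W.unop.hom ψ ≫ χ)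
        rw [restrictHom_comp, ← restrictHom_comp' W.unop.hom g.unop.left ψ]
        rfl }
    (fun W (a : Γ(X, W.unop.left)) (χ : B.over W.unop.left ⟶ N.over W.unop.left) => by
      change restrictHom W.unop.hom ψ ≫ (a • χ) = a • (restrictHom W.unop.hom ψ ≫ χ)
      rw [smul_overHom_def, smul_overHom_def, Category.assoc])

/-- Values of `precompOver N ψ`: `χ ↦ ψ|_W ≫ χ`. [cite: StacksProject, Tag 01CM (the internal Hom and its functoriality)] -/
@[simp]
lemma appLE_precompOver (ψ : A.over U ⟶ B.over U) {W : X.Opens} (k : W ⟶ U)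
    (χ : B.over W ⟶ N.over W) :
    appLE (precompOver N ψ) k (χ : Γ(sheafHom B N, W)) =
      ((restrictHom k ψ ≫ χ : A.over W ⟶ N.over W) : Γ(sheafHom A N, W)) := rfl

/-- `precompOver` is additive in `ψ`. [cite: StacksProject, Tag 01CM (the internal Hom and its functoriality)] -/
lemma precompOver_add (ψ ψ' : A.over U ⟶ B.over U) :
    precompOver N (ψ + ψ') = precompOver N ψ + precompOver N ψ' := by
  refine hom_ext_of_appLE fun W k (χ : B.over W ⟶ N.over W) => ?_
  rw [appLE_add, appLE_precompOver, appLE_precompOver, appLE_precompOver, restrictHom_add,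
    Preadditive.add_comp]
  rfl

/-- `precompOver N 0 = 0`. [cite: StacksProject, Tag 01CM (the internal Hom and its functoriality)] -/
@[simp]
lemma precompOver_zero : precompOver N (0 : A.over U ⟶ B.over U) = 0 := by
  refine hom_ext_of_appLE fun W k (χ : B.over W ⟶ N.over W) => ?_
  rw [appLE_precompOver, appLE_zero, restrictHom_zero, zero_comp]
  rfl

/-- `precompOver` is `𝒪_X(U)`-linear in `ψ`: `(a • ψ)| ≫ χ = a| • (ψ| ≫ χ)`. [cite: StacksProject, Tag 01CM (the internal Hom and its functoriality)] -/
lemma precompOver_smul (a : Γ(X, U)) (ψ : A.over U ⟶ B.over U) :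
    precompOver N (a • ψ) = a • precompOver N ψ := by
  refine hom_ext_of_appLE fun W k (χ : B.over W ⟶ N.over W) => ?_
  rw [appLE_precompOver, appLE_smul, appLE_precompOver, restrictHom_smul]
  change (X.presheaf.map k.op a • restrictHom k ψ) ≫ χ = X.presheaf.map k.op a • (restrictHom k ψ ≫ χ)
  simp only [smul_overHom_def, Category.assoc, overScalar_comp_eq']

/-- `precompOver` commutes with restriction to a smaller open. [cite: StacksProject, Tag 01CM (the internal Hom and its functoriality)] -/
lemma restrictHom_precompOver (i : V ⟶ U) (ψ : A.over U ⟶ B.over U) :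
    restrictHom i (precompOver N ψ) = precompOver N (restrictHom i ψ) := by
  refine hom_ext_of_appLE fun W k (χ : B.over W ⟶ N.over W) => ?_
  rw [appLE_restrictHom, appLE_precompOver, appLE_precompOver, restrictHom_comp']

/-- Contravariance: `precompOver N (ψ ≫ ψ') = precompOver N ψ' ≫ precompOver N ψ`. [cite: StacksProject, Tag 01CM (the internal Hom and its functoriality)] -/
lemma precompOver_comp (ψ : A.over U ⟶ B.over U) (ψ' : B.over U ⟶ C.over U) :
    precompOver N (ψ ≫ ψ') = precompOver N ψ' ≫ precompOver N ψ := by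
  refine hom_ext_of_appLE fun W k (χ : C.over W ⟶ N.over W) => ?_
  rw [appLE_comp, appLE_precompOver, appLE_precompOver, appLE_precompOver, restrictHom_comp,
    Category.assoc]

/-- `precompOver N (𝟙) = 𝟙`. [cite: StacksProject, Tag 01CM (the internal Hom and its functoriality)] -/
@[simp]
lemma precompOver_id : precompOver N (𝟙 (A.over U)) = 𝟙 _ := by
  refine hom_ext_of_appLE fun W k (χ : A.over W ⟶ N.over W) => ?_
  rw [appLE_precompOver, appLE_id, restrictHom_id, Category.id_comp]

/-- For a GLOBAL `φ : A → B`, pre-composition with `φ|_U` is the restriction to `U` of the tree's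
`sheafHomMapLeft φ N : 𝓗om(B, N) → 𝓗om(A, N)`. [cite: StacksProject, Tag 01CM] -/
lemma precompOver_over_map (φ : A ⟶ B) :
    precompOver N ((SheafOfModules.overFunctor _ U).map φ) =
      (SheafOfModules.overFunctor _ U).map (sheafHomMapLeft φ N) := by
  refine hom_ext_of_appLE fun W k (χ : B.over W ⟶ N.over W) => ?_
  rw [appLE_precompOver, appLE_over_map, sheafHomMapLeft_app_apply, restrictHom_over_map]

/-- Pre-composition commutes with post-composition: for `g : N → N'`,
`precompOver N ψ ≫ 𝓗om(A, g)|_U = 𝓗om(B, g)|_U ≫ precompOver N' ψ`. [cite: StacksProject, Tag 01CM] -/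
lemma precompOver_comp_over_sheafHomMap {N' : X.Modules} (g : N ⟶ N') (ψ : A.over U ⟶ B.over U) :
    precompOver N ψ ≫ (SheafOfModules.overFunctor _ U).map (sheafHomMap A g) =
      (SheafOfModules.overFunctor _ U).map (sheafHomMap B g) ≫ precompOver N' ψ := by
  refine hom_ext_of_appLE fun W k (χ : B.over W ⟶ N.over W) => ?_
  rw [appLE_comp, appLE_comp, appLE_precompOver, appLE_over_map, appLE_over_map,
    sheafHomMap_app_apply, sheafHomMap_app_apply, appLE_precompOver, Category.assoc]

end Precomp

/-! ### The internal transpose -/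

section Transpose

variable (A B N : X.Modules) {U : X.Opens}

/-- **The internal transpose** `𝓗om(A, B) ⟶ 𝓗om(𝓗om(B, N), 𝓗om(A, N))`, `ψ ↦ (χ ↦ ψ| ≫ χ)` on local
sections: the internal Hom as a functor contravariant in the first variable, internally (for `N = 𝒪_X`:
`ψ ↦ ψ^∨ : B^∨ → A^∨`). [cite: StacksProject, Tag 01CM (the internal Hom is functorial in both variables)] [cite: Hartshorne1977, II Ex. 5.1] -/
def transposeHom : sheafHom A B ⟶ sheafHom (sheafHom B N) (sheafHom A N) where
  val := PresheafOfModules.homMk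
    { app := fun U => AddCommGrpCat.ofHom
        { toFun := fun ψ : A.over U.unop ⟶ B.over U.unop =>
            (precompOver N ψ : (sheafHom B N).over U.unop ⟶ (sheafHom A N).over U.unop)
          map_zero' := precompOver_zero N
          map_add' := fun ψ ψ' => precompOver_add N ψ ψ' }
      naturality := fun {U V} i => by
        refine AddCommGrpCat.ext fun (ψ : A.over U.unop ⟶ B.over U.unop) => ?_
        exact (restrictHom_precompOver N i.unop ψ).symm }
    (fun U (a : Γ(X, U.unop)) (ψ : A.over U.unop ⟶ B.over U.unop) => precompOver_smul N a ψ)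

/-- Sections of the internal transpose: `ψ ↦ precompOver N ψ`. [cite: StacksProject, Tag 01CM (the internal Hom and its functoriality)] -/
@[simp]
lemma transposeHom_app_apply (U : X.Opens) (ψ : A.over U ⟶ B.over U) :
    (transposeHom A B N).app U ψ =
      (precompOver N ψ : (sheafHom B N).over U ⟶ (sheafHom A N).over U) := rfl

variable {A B}

/-- **Double transpose is biduality, locally**: for a local `ψ : A|_U → B|_U`,
`ev^A|_U ≫ ψ^∨∨ = ψ ≫ ev^B|_U` as morphisms `A|_U → 𝓗om(𝓗om(B, N), N)|_U` — `toBidual` is natural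
in LOCAL morphisms too (`Modules/Biduality.lean`, `toBidual_naturality`, is the global case): on
sections, `ev_s(ψ| ≫ χ) = χ(ψ s) = ev_{ψ s}(χ)`. [cite: Hartshorne1977, II Ex. 5.1 (a)] -/
theorem over_toBidual_comp_precompOver_precompOver (ψ : A.over U ⟶ B.over U) :
    (SheafOfModules.overFunctor _ U).map (toBidual A N) ≫ precompOver N (precompOver N ψ) =
      ψ ≫ (SheafOfModules.overFunctor _ U).map (toBidual B N) := by
  refine hom_ext_of_appLE fun W k (s : Γ(A, W)) => ?_
  rw [appLE_comp, appLE_over_map, toBidual_app_apply, appLE_precompOver, appLE_comp,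
    appLE_over_map, toBidual_app_apply, restrictHom_precompOver]
  refine hom_ext_of_appLE fun W' l (χ : B.over W' ⟶ N.over W') => ?_
  rw [appLE_comp, appLE_precompOver, appLE_evalAt, appLE_evalAt, appLE_comp, appLE_restrictHom,
    appLE_restrictHom, Category.id_comp, appLE_map]

variable (A B)

/-- **Double transpose is biduality, globally**:
`T_{A,B} ≫ T_{𝓗om(B,N),𝓗om(A,N)} ≫ 𝓗om(ev^A, –) = 𝓗om(A, ev^B)` as morphisms
`𝓗om(A, B) → 𝓗om(A, 𝓗om(𝓗om(B, N), N))` (`ψ ↦ ev^A ≫ ψ^∨∨ = ψ ≫ ev^B`). [cite: Hartshorne1977, II Ex. 5.1 (a)] -/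
theorem transposeHom_comp_transposeHom :
    transposeHom A B N ≫ transposeHom (sheafHom B N) (sheafHom A N) N ≫
        sheafHomMapLeft (toBidual A N) (sheafHom (sheafHom B N) N) =
      sheafHomMap A (toBidual B N) := by
  refine Scheme.Modules.hom_ext _ _ fun U => ?_
  rw [Scheme.Modules.Hom.comp_app, Scheme.Modules.Hom.comp_app]
  refine AddCommGrpCat.ext fun (ψ : A.over U ⟶ B.over U) => ?_
  change (sheafHomMapLeft (toBidual A N) (sheafHom (sheafHom B N) N)).app U
      ((transposeHom (sheafHom B N) (sheafHom A N) N).app U ((transposeHom A B N).app U ψ)) =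
    (sheafHomMap A (toBidual B N)).app U ψ
  rw [transposeHom_app_apply, transposeHom_app_apply, sheafHomMapLeft_app_apply,
    sheafHomMap_app_apply]
  exact over_toBidual_comp_precompOver_precompOver N ψ

end Transpose

/-! ### `𝓗om(A, B) ≅ 𝓗om(B^∨, A^∨)` for finite locally free `A`, `B` -/

section Iso

variable (A B : X.Modules)

/-- The transpose into duals: `𝓗om(A, B) → 𝓗om(B^∨, A^∨)`, `ψ ↦ ψ^∨` (`N = 𝒪_X`). [cite: Hartshorne1977, II Ex. 5.1] -/
abbrev transposeDual : sheafHom A B ⟶ sheafHom (dual B) (dual A) :=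
  transposeHom A B (unitModule X)

/-- With `A` finite locally free (so that `ev^A` is an isomorphism, `isIso_toBidual`), the double
transpose `T_{A,B} ≫ T_{B^∨,A^∨}` is conjugation by the biduality maps:
`= 𝓗om(A, ev^B) ≫ 𝓗om(ev^A, B^∨∨)⁻¹`. [cite: Hartshorne1977, II Ex. 5.1 (a)] -/
theorem transposeDual_comp_transposeDual (hA : IsFiniteLocallyFree A) :
    transposeDual A B ≫ transposeDual (dual B) (dual A) =
      haveI := isIso_toBidual A hA
      sheafHomMap A (toBidual B (unitModule X)) ≫
        sheafHomMapLeft (inv (toBidual A (unitModule X))) (dual (dual B)) := by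
  haveI := isIso_toBidual A hA
  have h := transposeHom_comp_transposeHom A B (unitModule X)
  rw [← h, Category.assoc, Category.assoc, ← sheafHomMapLeft_comp, IsIso.inv_hom_id,
    sheafHomMapLeft_id, Category.comp_id]

/-- Hence, for `A` finite locally free, `T_{A,B} ≫ T_{B^∨,A^∨}` is an isomorphism. [cite: Hartshorne1977, II Ex. 5.1 (a)] -/
theorem isIso_transposeDual_comp_transposeDual (hA : IsFiniteLocallyFree A) (hB : IsFiniteLocallyFree B) :
    IsIso (transposeDual A B ≫ transposeDual (dual B) (dual A)) := by
  haveI := isIso_toBidual A hA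
  haveI := isIso_toBidual B hB
  haveI : IsIso (sheafHomMap A (toBidual B (unitModule X))) :=
    (inferInstance : IsIso ((sheafHomFunctor A).map (toBidual B (unitModule X))))
  haveI : IsIso (sheafHomMapLeft (inv (toBidual A (unitModule X))) (dual (dual B))) :=
    ⟨⟨sheafHomMapLeft (toBidual A (unitModule X)) (dual (dual B)), by
      rw [← sheafHomMapLeft_comp, IsIso.hom_inv_id, sheafHomMapLeft_id], by
      rw [← sheafHomMapLeft_comp, IsIso.inv_hom_id, sheafHomMapLeft_id]⟩⟩
  rw [transposeDual_comp_transposeDual A B hA]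
  infer_instance

/-- **`𝓗om(A, B) ≅ 𝓗om(B^∨, A^∨)` for finite locally free `A`, `B`**: the transpose `ψ ↦ ψ^∨` is an
isomorphism (Hartshorne II Ex. 5.1: both sides are `A^∨ ⊗ B`). Frame-free proof from biduality: by
`isIso_transposeDual_comp_transposeDual` for `(A, B)` the transpose `T_{B^∨,A^∨}` is a split
epimorphism, and for `(B^∨, A^∨)` (finite locally free duals, `isFiniteLocallyFree_dual`) it is a
split monomorphism; so it is an isomorphism, and then so is `T_{A,B}`. [cite: Hartshorne1977, II Ex. 5.1 (b)] -/
theorem isIso_transposeDual (hA : IsFiniteLocallyFree A) (hB : IsFiniteLocallyFree B) :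
    IsIso (transposeDual A B) := by
  -- `T₂ := T_{B^∨, A^∨}` is a split epi (from `(A, B)`) and a split mono (from `(B^∨, A^∨)`)
  have h₁ := isIso_transposeDual_comp_transposeDual A B hA hB
  have h₂ := isIso_transposeDual_comp_transposeDual (dual B) (dual A)
    (isFiniteLocallyFree_dual hB) (isFiniteLocallyFree_dual hA)
  haveI : IsSplitEpi (transposeDual (dual B) (dual A)) :=
    IsSplitEpi.mk' ⟨inv (transposeDual A B ≫ transposeDual (dual B) (dual A)) ≫ transposeDual A B,
      by rw [Category.assoc, IsIso.inv_hom_id]⟩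
  haveI : IsSplitMono (transposeDual (dual B) (dual A)) :=
    IsSplitMono.mk' ⟨transposeDual (dual (dual A)) (dual (dual B)) ≫
        inv (transposeDual (dual B) (dual A) ≫ transposeDual (dual (dual A)) (dual (dual B))),
      by rw [← Category.assoc, IsIso.hom_inv_id]⟩
  haveI : IsIso (transposeDual (dual B) (dual A)) := isIso_of_mono_of_isSplitEpi _
  exact IsIso.of_isIso_comp_right (transposeDual A B) (transposeDual (dual B) (dual A))

/-- Consequently the transpose is bijective on sections over every open: every local morphism
`B^∨|_U → A^∨|_U` is `ψ^∨` for a unique `ψ : A|_U → B|_U` (`A`, `B` finite locally free). [cite: Hartshorne1977, II Ex. 5.1 (b)] -/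
theorem precompOver_bijective (hA : IsFiniteLocallyFree A) (hB : IsFiniteLocallyFree B) (U : X.Opens) :
    Function.Bijective (fun ψ : A.over U ⟶ B.over U =>
      (precompOver (unitModule X) ψ : (dual B).over U ⟶ (dual A).over U)) := by
  haveI := isIso_transposeDual A B hA hB
  let i : sheafHom A B ≅ sheafHom (dual B) (dual A) := asIso (transposeDual A B)
  have h₁ : ∀ ψ : Γ(sheafHom A B, U), i.inv.app U (i.hom.app U ψ) = ψ := fun ψ => by
    change (i.hom ≫ i.inv).app U ψ = ψ
    rw [Iso.hom_inv_id]
    rfl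
  have h₂ : ∀ Φ : Γ(sheafHom (dual B) (dual A), U), i.hom.app U (i.inv.app U Φ) = Φ := fun Φ => by
    change (i.inv ≫ i.hom).app U Φ = Φ
    rw [Iso.inv_hom_id]
    rfl
  refine ⟨fun ψ ψ' h => ?_, fun Φ => ⟨i.inv.app U Φ, h₂ Φ⟩⟩
  have h' : i.hom.app U ψ = i.hom.app U ψ' := h
  rw [← h₁ ψ, ← h₁ ψ', h']

end Iso

end Literature.AlgebraicGeometry.Modules

end
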